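import Summits.CriticalPhenomena.PercolationContinuityZ3.Theorems.PercNearOneGluingNoHeavyQuantStarAnimalCountDFS
import HarnessLib

/-!
# QUANT lane / PAPER-2 rate track (ARM-2 = constants bookkeeper, gen 5): the slot decomposition of an animal —
# `S ∖ {x}` splits into connected components, one per occupied neighbour slot of `x`

builds on p205010 (kernel theorem, internal audit signed; external expert review pending)

Cell `prim-quant`, seat `prim-quant-arm-2` (`run/shared/lean/prim/quant/prim-quant-arm-2/RATE-CONSTANTS.md` §8, lever (L1a⁗)).
First of the files that move the Peierls constant of the Kozma–Nitzan exploration driver from `2⁻⁶` (ARM-1 g3, depth-first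
count `#starAnimals v m ≤ 32^{m−1}`, `…QuantStarAnimalCountDFS`) to `2⁻⁵`, by the classical Galton–Watson (Fuss–Catalan)
majorant of lattice animals: an animal `S ∋ x` (a finite vertex set connected from `x` by `R`-steps inside `S`) is `{x}` together
with the connected components of `S ∖ {x}`; each component contains a neighbour of `x`, and choosing one such neighbour per
component files the components into the (at most `Δ`) neighbour SLOTS of `x`, disjointly, each filed component being again an
animal through its slot vertex.  This file is the pure combinatorics of that decomposition (generic over a symmetric step relation
`R` with `R a b → b ∈ nbr a`):

* `IsAnimal R x S`, `animals R nbr Δ x n` (the animals through `x` with `n + 1` points, a filter of ARM-1's depth-first family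
  `DFSCount.dfsFamily`; `mem_animals`);
* `comp R T a` (the component of `a` in `T`), `rep N K` (a chosen point of `K ∩ N`), `slot R nbr x S a` (the component of
  `S ∖ {x}` filed at the neighbour `a` of `x`, or `∅`);
* `biUnion_slot` (the slots cover `S ∖ {x}`), `pairwiseDisjoint_slot`, `card_eq_sum_card_slot` (`#S = 1 + Σ_a #slot a`),
  `isAnimal_slot` (a nonempty slot is an animal through its vertex), `eq_of_slot_eq` (the slot map is injective).

The count `#animals ≤ gw Δ (n+1)` with `gw` the `Δ`-ary tree numbers, its generating-function majorant and the `d = 2` certificate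
at `ε = 2⁻⁵` are in `…QuantGWAnimalCount`.  Pure combinatorics; no percolation input.
(Classical: the number of lattice animals of size `m` through a point of a graph of degree `≤ Δ` is at most the number of
`m`-vertex subtrees through the root of the `Δ`-ary tree; e.g. Grimmett, *Percolation* (1999), proof of (4.24).) [folklore]
-/

noncomputable section

namespace Summit.CriticalPhenomena.PercolationContinuityZ3.Theorems.Quant.GWCount

open Finset Relation
open scoped Classical

section Basic

variable {V : Type*}

/-! ## Animals through a point -/

/-- The step relation restricted to a finite set `T`. [folklore] -/
def RIn (R : V → V → Prop) (T : Finset V) (a b : V) : Prop := R a b ∧ a ∈ T ∧ b ∈ T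

/-- `S` is an animal through `x`: `x ∈ S` and every point of `S` is reached from `x` by `R`-steps inside `S`.
builds on p205010 (kernel theorem, internal audit signed; external expert review pending). [folklore] -/
def IsAnimal (R : V → V → Prop) (x : V) (S : Finset V) : Prop :=
  x ∈ S ∧ ∀ w ∈ S, ReflTransGen (RIn R S) x w

variable {R : V → V → Prop}

/-- An animal with one point is `{x}`. [folklore] -/
theorem eq_singleton_of_isAnimal {x : V} {S : Finset V} (hS : IsAnimal R x S) (hcard : S.card = 1) : S = {x} := by
  obtain ⟨y, rfl⟩ := card_eq_one.1 hcard
  rw [mem_singleton.1 hS.1]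

/-! ## Components -/

/-- The component of `a` in `T`: the points of `T` reached from `a` by `R`-steps inside `T`. [folklore] -/
def comp (R : V → V → Prop) (T : Finset V) (a : V) : Finset V := T.filter fun u => ReflTransGen (RIn R T) a u

/-- A component lies in the ambient set. [folklore] -/
theorem comp_subset (T : Finset V) (a : V) : comp R T a ⊆ T := filter_subset _ _

/-- Membership in a component. [folklore] -/
theorem mem_comp {T : Finset V} {a u : V} : u ∈ comp R T a ↔ u ∈ T ∧ ReflTransGen (RIn R T) a u := mem_filter

/-- A point of `T` is in its own component. [folklore] -/
theorem mem_comp_self {T : Finset V} {a : V} (ha : a ∈ T) : a ∈ comp R T a := mem_comp.2 ⟨ha, ReflTransGen.refl⟩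

/-- The restricted relation is symmetric when `R` is. [folklore] -/
theorem rIn_symm (hR : ∀ a b, R a b → R b a) {T : Finset V} {a b : V} (h : RIn R T a b) : RIn R T b a :=
  ⟨hR _ _ h.1, h.2.2, h.2.1⟩

/-- Paths inside `T` reverse (for a symmetric step relation). [folklore] -/
theorem reflTransGen_rIn_symm (hR : ∀ a b, R a b → R b a) {T : Finset V} {a b : V} (h : ReflTransGen (RIn R T) a b) :
    ReflTransGen (RIn R T) b a := by
  induction h with
  | refl => exact ReflTransGen.refl
  | tail _ hbc ih => exact ReflTransGen.head (rIn_symm hR hbc) ih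

/-- Components are classes: a point of the component of `a` has the same component. [folklore] -/
theorem comp_eq_of_mem (hR : ∀ a b, R a b → R b a) {T : Finset V} {a u : V} (hu : u ∈ comp R T a) : comp R T u = comp R T a := by
  obtain ⟨-, hau⟩ := mem_comp.1 hu
  have hua : ReflTransGen (RIn R T) u a := reflTransGen_rIn_symm hR hau
  ext w
  simp only [mem_comp]
  exact ⟨fun h => ⟨h.1, hau.trans h.2⟩, fun h => ⟨h.1, hua.trans h.2⟩⟩

/-- A one-step neighbour inside `T` lies in the same component. [folklore] -/
theorem mem_comp_of_step {T : Finset V} {a b c : V} (hb : b ∈ comp R T a) (hbc : R b c) (hc : c ∈ T) : c ∈ comp R T a := by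
  obtain ⟨hbT, hab⟩ := mem_comp.1 hb
  exact mem_comp.2 ⟨hc, hab.tail ⟨hbc, hbT, hc⟩⟩

/-- **A component is an animal through each of its points** (the connecting paths stay inside the component). [folklore] -/
theorem isAnimal_comp {T : Finset V} {a : V} (ha : a ∈ T) : IsAnimal R a (comp R T a) := by
  refine ⟨mem_comp_self ha, fun w hw => ?_⟩
  obtain ⟨-, haw⟩ := mem_comp.1 hw
  induction haw with
  | refl => exact ReflTransGen.refl
  | tail hab hbc ih =>
    rename_i b c
    have hb : b ∈ comp R T a := mem_comp.2 ⟨hbc.2.1, hab⟩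
    have hc : c ∈ comp R T a := mem_comp.2 ⟨hbc.2.2, hab.tail hbc⟩
    exact (ih hb).tail ⟨hbc.1, hb, hc⟩

end Basic

section Slots

variable {V : Type*} [DecidableEq V] {R : V → V → Prop} {nbr : V → Finset V} {Δ : ℕ}

/-! ## The finite family of animals -/

variable (R nbr Δ) in
/-- The animals through `x` with `n + 1` points, as a finite family (a filter of the depth-first family of ARM-1's
`…QuantDFSCodes`; see `mem_animals`). builds on p205010 (kernel theorem, internal audit signed; external expert review pending). [folklore] -/
def animals (x : V) (n : ℕ) : Finset (Finset V) :=
  (DFSCount.dfsFamily nbr Δ x n).filter fun S => S.card = n + 1 ∧ IsAnimal R x S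

/-- Membership in `animals`: exactly the animals through `x` with `n + 1` points (every such set is a depth-first trace,
`DFSCount.mem_dfsFamily`). builds on p205010 (kernel theorem, internal audit signed; external expert review pending). [folklore] -/
theorem mem_animals (hnbr : ∀ a b, R a b → b ∈ nbr a) (hΔ : ∀ a, (nbr a).card ≤ Δ) {x : V} {n : ℕ} {S : Finset V} :
    S ∈ animals R nbr Δ x n ↔ S.card = n + 1 ∧ IsAnimal R x S :=
  ⟨fun h => (mem_filter.1 h).2, fun h => mem_filter.2 ⟨DFSCount.mem_dfsFamily hnbr hΔ n h.1 h.2.1 h.2.2, h⟩⟩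

/-- Members of `animals … x n` are nonempty (they contain `x`). [folklore] -/
theorem nonempty_of_mem_animals {x : V} {n : ℕ} {S : Finset V} (h : S ∈ animals R nbr Δ x n) : S.Nonempty :=
  ⟨x, (mem_filter.1 h).2.2.1⟩

/-! ## Representatives and slots -/

/-- A chosen point of `K ∩ N` (if any). [folklore] -/
def rep (N K : Finset V) : Option V := if h : (K ∩ N).Nonempty then some h.choose else none

/-- The representative lies in `K ∩ N`. [folklore] -/
theorem rep_spec {N K : Finset V} {a : V} (h : rep N K = some a) : a ∈ K ∧ a ∈ N := by
  unfold rep at h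
  split_ifs at h with hne
  · have := hne.choose_spec
    rw [Option.some.injEq] at h
    rw [← h]
    exact mem_inter.1 this

/-- A nonempty `K ∩ N` has a representative. [folklore] -/
theorem rep_isSome {N K : Finset V} (h : (K ∩ N).Nonempty) : ∃ a, rep N K = some a :=
  ⟨h.choose, by unfold rep; rw [dif_pos h]⟩

/-- **The slot map.**  For an animal `S` through `x` and a point `a`: the component of `a` in `S ∖ {x}` if `a` is the chosen
representative (among the neighbours of `x`) of that component, and `∅` otherwise.
builds on p205010 (kernel theorem, internal audit signed; external expert review pending). [folklore] -/
def slot (R : V → V → Prop) (nbr : V → Finset V) (x : V) (S : Finset V) (a : V) : Finset V :=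
  if a ∈ S.erase x ∧ rep (nbr x) (comp R (S.erase x) a) = some a then comp R (S.erase x) a else ∅

/-- Slots lie in `S ∖ {x}`. [folklore] -/
theorem slot_subset (x : V) (S : Finset V) (a : V) : slot R nbr x S a ⊆ S.erase x := by
  unfold slot
  split_ifs
  · exact comp_subset _ _
  · exact empty_subset _

/-- Only neighbour slots are occupied. [folklore] -/
theorem slot_eq_empty_of_not_mem {x : V} {S : Finset V} {a : V} (ha : a ∉ nbr x) : slot R nbr x S a = ∅ := by
  unfold slot
  split_ifs with h
  · exact absurd (rep_spec h.2).2 ha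
  · rfl

/-- A nonempty slot is the component of its (occupied) vertex, which is the representative. [folklore] -/
theorem slot_eq_comp_of_nonempty {x : V} {S : Finset V} {a : V} (h : (slot R nbr x S a).Nonempty) :
    (a ∈ S.erase x ∧ rep (nbr x) (comp R (S.erase x) a) = some a) ∧ slot R nbr x S a = comp R (S.erase x) a := by
  unfold slot at h ⊢
  by_cases hc : a ∈ S.erase x ∧ rep (nbr x) (comp R (S.erase x) a) = some a
  · exact ⟨hc, if_pos hc⟩
  · rw [if_neg hc] at h
    exact absurd h not_nonempty_empty

/-- **A nonempty slot is an animal through its vertex.** [folklore] -/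
theorem isAnimal_slot {x : V} {S : Finset V} {a : V} (h : (slot R nbr x S a).Nonempty) : IsAnimal R a (slot R nbr x S a) := by
  obtain ⟨⟨ha, -⟩, he⟩ := slot_eq_comp_of_nonempty h
  rw [he]
  exact isAnimal_comp ha

/-- **Distinct slots are disjoint.** [folklore] -/
theorem disjoint_slot (hR : ∀ a b, R a b → R b a) (x : V) (S : Finset V) {a a' : V} (hne : a ≠ a') :
    Disjoint (slot R nbr x S a) (slot R nbr x S a') := by
  rw [Finset.disjoint_left]
  intro u hu hu'
  obtain ⟨⟨-, hr⟩, he⟩ := slot_eq_comp_of_nonempty ⟨u, hu⟩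
  obtain ⟨⟨-, hr'⟩, he'⟩ := slot_eq_comp_of_nonempty ⟨u, hu'⟩
  rw [he] at hu
  rw [he'] at hu'
  rw [← comp_eq_of_mem hR hu, comp_eq_of_mem hR hu', hr'] at hr
  exact hne (Option.some.inj hr).symm

/-- The slots indexed by any set of points are pairwise disjoint. [folklore] -/
theorem pairwiseDisjoint_slot (hR : ∀ a b, R a b → R b a) (x : V) (S : Finset V) (N : Finset V) :
    (N : Set V).PairwiseDisjoint (slot R nbr x S) :=
  fun _ _ _ _ hne => disjoint_slot hR x S hne

/-- **Every point of `S ∖ {x}` is in the component of a neighbour of `x`** (follow a connecting path from `x` and restart it at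
its last visit to `x`). [folklore] -/
theorem comp_inter_nbr_nonempty (hR : ∀ a b, R a b → R b a) (hnbr : ∀ a b, R a b → b ∈ nbr a) {x : V} {S : Finset V}
    (hS : IsAnimal R x S) {u : V} (hu : u ∈ S.erase x) : (comp R (S.erase x) u ∩ nbr x).Nonempty := by
  have key : ∀ w, ReflTransGen (RIn R S) x w → w = x ∨ (w ∈ S.erase x ∧ (comp R (S.erase x) w ∩ nbr x).Nonempty) := by
    intro w hw
    induction hw with
    | refl => exact Or.inl rfl
    | tail hxb hbc ih =>
      rename_i b c
      by_cases hcx : c = x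
      · exact Or.inl hcx
      right
      have hc : c ∈ S.erase x := mem_erase.2 ⟨hcx, hbc.2.2⟩
      refine ⟨hc, ?_⟩
      rcases ih with rfl | ⟨hb, hbne⟩
      · exact ⟨c, mem_inter.2 ⟨mem_comp_self hc, hnbr _ _ hbc.1⟩⟩
      · have hcb : c ∈ comp R (S.erase x) b := mem_comp_of_step (mem_comp_self hb) hbc.1 hc
        rw [comp_eq_of_mem hR hcb]
        exact hbne
  rcases key u (hS.2 u (mem_of_mem_erase hu)) with hux | h
  · exact absurd hux (ne_of_mem_erase hu)
  · exact h.2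

/-- **The slots cover `S ∖ {x}`.** builds on p205010 (kernel theorem, internal audit signed; external expert review pending). [folklore] -/
theorem exists_mem_slot (hR : ∀ a b, R a b → R b a) (hnbr : ∀ a b, R a b → b ∈ nbr a) {x : V} {S : Finset V} (hS : IsAnimal R x S)
    {u : V} (hu : u ∈ S.erase x) : ∃ a ∈ nbr x, u ∈ slot R nbr x S a := by
  obtain ⟨a, ha⟩ := rep_isSome (comp_inter_nbr_nonempty hR hnbr hS hu)
  obtain ⟨haK, haN⟩ := rep_spec ha
  have hKa : comp R (S.erase x) a = comp R (S.erase x) u := comp_eq_of_mem hR haK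
  refine ⟨a, haN, ?_⟩
  have hcond : a ∈ S.erase x ∧ rep (nbr x) (comp R (S.erase x) a) = some a := ⟨comp_subset _ _ haK, by rw [hKa]; exact ha⟩
  unfold slot
  rw [if_pos hcond, hKa]
  exact mem_comp_self hu

/-- **The slot decomposition**: `⋃_{a ∈ nbr x} slot a = S ∖ {x}`. builds on p205010 (kernel theorem, internal audit signed; external expert review pending). [folklore] -/
theorem biUnion_slot (hR : ∀ a b, R a b → R b a) (hnbr : ∀ a b, R a b → b ∈ nbr a) {x : V} {S : Finset V} (hS : IsAnimal R x S) :
    (nbr x).biUnion (slot R nbr x S) = S.erase x := by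
  ext u
  simp only [mem_biUnion]
  exact ⟨fun ⟨a, _, hu⟩ => slot_subset x S a hu, fun hu => exists_mem_slot hR hnbr hS hu⟩

/-- `S = {x} ∪ ⋃_{a ∈ nbr x} slot a`. [folklore] -/
theorem eq_insert_biUnion_slot (hR : ∀ a b, R a b → R b a) (hnbr : ∀ a b, R a b → b ∈ nbr a) {x : V} {S : Finset V}
    (hS : IsAnimal R x S) : S = insert x ((nbr x).biUnion (slot R nbr x S)) := by
  rw [biUnion_slot hR hnbr hS, insert_erase hS.1]

/-- **Sizes add up**: `#S = 1 + Σ_{a ∈ nbr x} #slot a`. builds on p205010 (kernel theorem, internal audit signed; external expert review pending). [folklore] -/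
theorem card_eq_sum_card_slot (hR : ∀ a b, R a b → R b a) (hnbr : ∀ a b, R a b → b ∈ nbr a) {x : V} {S : Finset V}
    (hS : IsAnimal R x S) : S.card = (∑ a ∈ nbr x, (slot R nbr x S a).card) + 1 := by
  rw [← card_biUnion (pairwiseDisjoint_slot hR x S (nbr x)), biUnion_slot hR hnbr hS, card_erase_of_mem hS.1]
  have := card_pos.2 ⟨x, hS.1⟩
  omega

/-- **The slot map is injective on animals through `x`.** builds on p205010 (kernel theorem, internal audit signed; external expert review pending). [folklore] -/
theorem eq_of_slot_eq (hR : ∀ a b, R a b → R b a) (hnbr : ∀ a b, R a b → b ∈ nbr a) {x : V} {S S' : Finset V}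
    (hS : IsAnimal R x S) (hS' : IsAnimal R x S') (h : ∀ a ∈ nbr x, slot R nbr x S a = slot R nbr x S' a) : S = S' := by
  rw [eq_insert_biUnion_slot hR hnbr hS, eq_insert_biUnion_slot hR hnbr hS', biUnion_congr rfl h]

end Slots

end Summit.CriticalPhenomena.PercolationContinuityZ3.Theorems.Quant.GWCount

end
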